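import Literature.MathematicalPhysics.QuantumLattice.GroundStateSpinReflectionPositivityHubbard
import Literature.MathematicalPhysics.QuantumLattice.HubbardNNNHoppingRectSymmetries
import HarnessLib

/-!
# Lieb's Theorem 2 and the spin-reflection Gram block on even rectangular tori `ℤ/aℤ × ℤ/bℤ`

Topic `Literature/MathematicalPhysics/QuantumLattice`; the rectangular-torus companion of
`HubbardHalfFilledGroundStateTorus.lean` (Lieb's hypotheses and Theorem 2 on the even SQUARE torus
`(ℤ/Lℤ)²`) and of `GroundStateSpinReflectionPositivityHubbard.lean` (the Gram form of Lieb's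
spin-reflection positivity of THE half-filled ground state, `LiebTwo.liebGram_posSemidef`, stated
for every connected bipartite graph with equinumerous colour classes).

On the rectangular fermionic torus `fermionRectTorusGraph a b` (`HubbardRectangularTorus.lean`;
sites `Fin a ×ₗ Fin b`, nearest neighbours along both rings) with BOTH periods `a, b` even and
nonzero, Lieb's hypotheses hold with the staggering sign `rectStagger a b (x, y) = (-1)^{x+y}`
(`HubbardNNNHoppingRectSymmetries.lean`, `rectStagger_eq_neg_of_adj`):

* `LiebHalfFilled.fermionRectTorusGraph_connected` — the rectangular torus graph is connected
  (`a, b ≠ 0`; coordinate paths);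
* `LiebHalfFilled.two_mul_card_filter_rectStagger_eq_one` — for even `a, b` the two sublattices
  are equinumerous, `2 |{ε = +1}| = ab` (the unit shift in the first coordinate is a sign-flipping
  injection);
* `LiebHalfFilled.hubbardRectTorus_lieb_hypotheses` — the package (connected, `{ε = +1}` is a
  colour class, `2|A| = |Λ|`), hence Lieb's Theorem 2 on the even rectangular torus:
  `hubbardRectTorus_finrank_groundSector_eq_one` (the half-filled ground multiplet of
  `hamiltonian (fermionRectTorusGraph a b) t U`, `t ≠ 0`, `U > 0`, is one-dimensional and consists
  of singlets), `hubbardRectTorus_groundSector_le_szSector` (it lies in `S^z = 0`),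
  `hubbardRectTorus_exists_unit_groundState` (THE unit ground state `ψ ∈ szSector (ab) 0`, a
  singlet, with the uniqueness clause) and `hubbardRectTorus_spinSq_mulVec_eq_zero_of_eigen`;
* the Gram blocks of THE half-filled ground state (certificate block kinds `liebgram` /
  `liebgram_flip` on rectangular tori, e.g. `4 × 2`): `rectSign`,
  `hubbardRectTorus_liebGram_posSemidef`, `hubbardRectTorus_liebGram_posSemidef_flip`,
  `hubbardRectTorus_liebForm_expect_nonneg`, `hubbardRectTorus_liebFormFlip_expect_nonneg` —
  specialisations of the graph-generic theorems of `GroundStateSpinReflectionPositivityHubbard`.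

For `a = b = L` these are the square-torus statements (`squareToRect`,
`groundEnergyAt_fermionTorusGraph_two`). Odd periods are excluded (the rings are then not
bipartite), as is the degenerate period `1`.

## Sources

E. H. Lieb, *Two theorems on the Hubbard model*, Phys. Rev. Lett. 62 (1989) 1201, Theorem 2 and its
proof (hypotheses: `Λ` connected through `t_{xy}`, bipartite, `|A| = |B|`, `U > 0`; the periodic
square lattice with even periods is the motivating example; the positive-definite coefficient matrix
of the ground state) [LiebPRL1989]; I. Kull, N. Schuch, B. Dive, M. Navascués, *Lower bounds on
ground-state energies of local Hamiltonians through the renormalization group*, Phys. Rev. X 14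
(2024) 021008, §5.3 (extra positive-semidefinite constraints valid in the exact ground state
tighten a relaxation) [KullEtAl2024]. Everything here is proved; no named facts; private helpers
are elementary lattice bookkeeping ([folklore]).
-/

noncomputable section

namespace Literature.MathematicalPhysics.QuantumLattice

open Matrix Finset
open scoped ComplexOrder MatrixOrder

namespace LiebHalfFilled

section RectLattice

variable {a b : ℕ}

/-- `k ∼ k + 1` on the ring `ℤ/nℤ` (representatives) when `k + 1 < n`. [folklore] -/
private theorem ringAdj_succ {n k : ℕ} (hk : k + 1 < n) : ringAdj n k (k + 1) :=
  ⟨by omega, Or.inl (Nat.mod_eq_of_lt hk)⟩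

/-- Along the second ring: `(x, 0) ↝ (x, n)`. [folklore] -/
private theorem rect_reachable_col (hb : 0 < b) (x : Fin a) :
    ∀ (n : ℕ) (hn : n < b), (fermionRectTorusGraph a b).Reachable
      (toLex (x, (⟨0, hb⟩ : Fin b))) (toLex (x, (⟨n, hn⟩ : Fin b))) := by
  intro n
  induction n with
  | zero => intro hn; exact SimpleGraph.Reachable.refl _
  | succ n ih =>
      intro hn
      refine (ih (by omega)).trans (SimpleGraph.Adj.reachable ?_)
      exact (fermionRectTorusGraph_adj_iff _ _).2 (Or.inr ⟨rfl, ringAdj_succ hn⟩)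

/-- Along the first ring: `(0, y) ↝ (n, y)`. [folklore] -/
private theorem rect_reachable_row (ha : 0 < a) (y : Fin b) :
    ∀ (n : ℕ) (hn : n < a), (fermionRectTorusGraph a b).Reachable
      (toLex ((⟨0, ha⟩ : Fin a), y)) (toLex ((⟨n, hn⟩ : Fin a), y)) := by
  intro n
  induction n with
  | zero => intro hn; exact SimpleGraph.Reachable.refl _
  | succ n ih =>
      intro hn
      refine (ih (by omega)).trans (SimpleGraph.Adj.reachable ?_)
      exact (fermionRectTorusGraph_adj_iff _ _).2 (Or.inl ⟨rfl, ringAdj_succ hn⟩)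

variable [NeZero a] [NeZero b]

variable (a b) in
/-- **The rectangular fermionic torus `ℤ/aℤ × ℤ/bℤ` is connected** (`a, b ≠ 0`): every site is
reached from `(0, 0)` along the first ring and then the second. Lieb's connectivity hypothesis
("`Λ` is connected through the hopping matrix") for this lattice.
[cite: LiebPRL1989, Theorem 2 (connectivity hypothesis)] -/
theorem fermionRectTorusGraph_connected : (fermionRectTorusGraph a b).Connected := by
  have ha : 0 < a := Nat.pos_of_ne_zero (NeZero.ne a)
  have hb : 0 < b := Nat.pos_of_ne_zero (NeZero.ne b)
  refine (SimpleGraph.connected_iff_exists_forall_reachable _).2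
    ⟨toLex ((⟨0, ha⟩ : Fin a), (⟨0, hb⟩ : Fin b)), fun p => ?_⟩
  have hp : p = toLex ((⟨((ofLex p).1 : ℕ), (ofLex p).1.isLt⟩ : Fin a),
      (⟨((ofLex p).2 : ℕ), (ofLex p).2.isLt⟩ : Fin b)) := by
    simp only [Fin.eta, Prod.mk.eta, toLex_ofLex]
  rw [hp]
  exact (rect_reachable_row ha _ _ (ofLex p).1.isLt).trans
    ((rect_reachable_col hb _ _ (ofLex p).2.isLt))

/-- For `a` even and nonzero, `1 < a`. [folklore] -/
private theorem one_lt_of_even (ha : Even a) : 1 < a := by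
  obtain ⟨m, hm⟩ := ha
  have h0 : a ≠ 0 := NeZero.ne a
  omega

/-- The value of the unit shift `x ↦ x + 1` in `Fin a` (`1 < a`): `(x + 1 : Fin a) = (x + 1) mod a`
on representatives. [folklore] -/
private theorem val_add_one (h1 : 1 < a) (x : Fin a) : ((x + 1 : Fin a) : ℕ) = ((x : ℕ) + 1) % a := by
  rw [Fin.val_add, Fin.val_one', Nat.mod_eq_of_lt h1]

omit [NeZero b] in
/-- The unit shift in the first coordinate is a nearest-neighbour move (`1 < a`). [folklore] -/
private theorem adj_shift (h1 : 1 < a) (p : Fin a ×ₗ Fin b) :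
    (fermionRectTorusGraph a b).Adj p (toLex ((ofLex p).1 + 1, (ofLex p).2)) := by
  refine (fermionRectTorusGraph_adj_iff _ _).2 (Or.inl ⟨rfl, ?_, Or.inl ?_⟩)
  · change ((ofLex p).1 : ℕ) ≠ (((ofLex p).1 + 1 : Fin a) : ℕ)
    rw [val_add_one h1]
    intro h
    rcases Nat.lt_or_ge (((ofLex p).1 : ℕ) + 1) a with hlt | hge
    · rw [Nat.mod_eq_of_lt hlt] at h; omega
    · have heq : ((ofLex p).1 : ℕ) + 1 = a := by have := (ofLex p).1.isLt; omega
      rw [heq, Nat.mod_self] at h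
      omega
  · change (((ofLex p).1 : ℕ) + 1) % a = (((ofLex p).1 + 1 : Fin a) : ℕ)
    rw [val_add_one h1]

omit [NeZero b] in
/-- **The two sublattices of the even rectangular torus are equinumerous**: for `a, b` even the
staggering sign `ε_{(x,y)} = (-1)^{x+y}` takes the value `+1` on exactly `ab/2` sites (the unit
shift in the first coordinate is a sign-flipping injection). Lieb's hypothesis `|A| = |B|` for this
lattice. [cite: LiebPRL1989, Theorem 2 (`|A| = |B|`)] -/
theorem two_mul_card_filter_rectStagger_eq_one (ha : Even a) (hb : Even b) :
    2 * (univ.filter fun p : Fin a ×ₗ Fin b => rectStagger a b p = 1).card = a * b := by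
  have h1 : 1 < a := one_lt_of_even ha
  set A : Finset (Fin a ×ₗ Fin b) := univ.filter fun p : Fin a ×ₗ Fin b => rectStagger a b p = 1
    with hA
  set s : Fin a ×ₗ Fin b → Fin a ×ₗ Fin b := fun p => toLex ((ofLex p).1 + 1, (ofLex p).2) with hs
  have hs_inj : Function.Injective s := by
    intro p q h
    have h' := congrArg ofLex h
    simp only [hs, ofLex_toLex, Prod.mk.injEq, add_left_inj] at h'
    exact ofLex.injective (Prod.ext h'.1 h'.2)
  have hflip : ∀ p, rectStagger a b (s p) = -rectStagger a b p := fun p => by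
    have h := rectStagger_eq_neg_of_adj ha hb (adj_shift h1 p)
    rw [h, neg_neg]
  have hmemA : ∀ p, p ∈ A ↔ rectStagger a b p = 1 := fun p => by
    rw [hA, mem_filter]
    exact ⟨fun h => h.2, fun h => ⟨mem_univ _, h⟩⟩
  have i1 : A.map ⟨s, hs_inj⟩ ⊆ Aᶜ := by
    intro q hq
    rw [mem_map] at hq
    obtain ⟨p, hp, rfl⟩ := hq
    rw [mem_compl, hmemA]
    rw [hmemA] at hp
    change rectStagger a b (s p) ≠ 1
    rw [hflip, hp]
    exact Int.units_ne_iff_eq_neg.2 rfl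
  have i2 : Aᶜ.map ⟨s, hs_inj⟩ ⊆ A := by
    intro q hq
    rw [mem_map] at hq
    obtain ⟨p, hp, rfl⟩ := hq
    rw [mem_compl, hmemA] at hp
    rw [hmemA]
    change rectStagger a b (s p) = 1
    rw [hflip, Int.units_ne_iff_eq_neg.1 hp, neg_neg]
  have c1 : A.card ≤ Aᶜ.card := by simpa using card_le_card i1
  have c2 : Aᶜ.card ≤ A.card := by simpa using card_le_card i2
  have hc : Aᶜ.card = A.card := le_antisymm c2 c1
  have htot := Finset.card_add_card_compl A
  rw [hc, card_rectSites] at htot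
  omega

/-- **Lieb's hypotheses on the even rectangular torus.** For `a, b` even and nonzero, with `A`
the sublattice `{p : ε_p = +1}` of the staggering sign `rectStagger`: the torus graph is connected,
`A` is a colour class (`p ∼ q → (p ∈ A ↔ q ∉ A)`), and `2|A| = |Λ|`.
[cite: LiebPRL1989, Theorem 2 (bipartite lattice, `|A| = |B|`)] -/
theorem hubbardRectTorus_lieb_hypotheses (ha : Even a) (hb : Even b) :
    (fermionRectTorusGraph a b).Connected ∧
      (∀ p q : Fin a ×ₗ Fin b, (fermionRectTorusGraph a b).Adj p q →
        (p ∈ (univ.filter fun p : Fin a ×ₗ Fin b => rectStagger a b p = 1) ↔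
          q ∉ (univ.filter fun p : Fin a ×ₗ Fin b => rectStagger a b p = 1))) ∧
      2 * (univ.filter fun p : Fin a ×ₗ Fin b => rectStagger a b p = 1).card =
        Fintype.card (Fin a ×ₗ Fin b) := by
  refine ⟨fermionRectTorusGraph_connected a b, fun p q hpq => ?_, ?_⟩
  · have h := rectStagger_eq_neg_of_adj ha hb hpq
    simp only [mem_filter, mem_univ, true_and]
    rw [h]
    change -rectStagger a b q = 1 ↔ rectStagger a b q ≠ 1
    rw [Int.units_ne_iff_eq_neg, neg_eq_iff_eq_neg]
  · rw [two_mul_card_filter_rectStagger_eq_one ha hb, card_rectSites]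

/-- **Lieb's Theorem 2 on the even rectangular torus**: for `a, b` even and nonzero, `t ≠ 0`,
`U > 0`, the `ab`-particle (half-filled) ground multiplet of `hamiltonian (fermionRectTorusGraph a b)
t U` is one-dimensional and consists of singlets. [cite: LiebPRL1989, Theorem 2] -/
theorem hubbardRectTorus_finrank_groundSector_eq_one (ha : Even a) (hb : Even b) {t U : ℝ}
    (ht : t ≠ 0) (hU : 0 < U) :
    Module.finrank ℂ ((hamiltonian (fermionRectTorusGraph a b) t U).sectorGroundSpace
        (nParticleSubmodule (ι := Orb (Fin a ×ₗ Fin b)) (a * b))) = 1 ∧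
      ∀ ψ ∈ (hamiltonian (fermionRectTorusGraph a b) t U).sectorGroundSpace
          (nParticleSubmodule (ι := Orb (Fin a ×ₗ Fin b)) (a * b)), spinSq *ᵥ ψ = 0 := by
  obtain ⟨hG, hA, h2⟩ := hubbardRectTorus_lieb_hypotheses (a := a) (b := b) ha hb
  have hcard := compl_card_eq_card_of_two_mul h2
  have h := finrank_groundSector_eq_one hG _ hA hcard ht hU
  rwa [card_rectSites] at h

/-- **The half-filled ground states of the even rectangular torus lie in the central sector**
`S^z = 0`. [cite: LiebPRL1989, Theorem 2] -/
theorem hubbardRectTorus_groundSector_le_szSector (ha : Even a) (hb : Even b) {t U : ℝ}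
    (ht : t ≠ 0) (hU : 0 < U) :
    (hamiltonian (fermionRectTorusGraph a b) t U).sectorGroundSpace
        (nParticleSubmodule (ι := Orb (Fin a ×ₗ Fin b)) (a * b)) ≤ szSector (a * b) 0 := by
  obtain ⟨hG, hA, h2⟩ := hubbardRectTorus_lieb_hypotheses (a := a) (b := b) ha hb
  have hcard := compl_card_eq_card_of_two_mul h2
  have h := groundSector_le_szSector hG _ hA hcard ht hU
  rwa [card_rectSites] at h

/-- **THE half-filled ground state of the even rectangular torus.** For `a, b` even and nonzero,
`t ≠ 0`, `U > 0` there is a unit vector `ψ ∈ szSector (ab) 0` with `H ψ = E₀(ab) ψ` and `S² ψ = 0`,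
and every `ab`-particle ground state is `⟨ψ, φ⟩ ψ`. [cite: LiebPRL1989, Theorem 2] -/
theorem hubbardRectTorus_exists_unit_groundState (ha : Even a) (hb : Even b) {t U : ℝ}
    (ht : t ≠ 0) (hU : 0 < U) :
    ∃ ψ ∈ szSector (a * b) 0, star ψ ⬝ᵥ ψ = 1 ∧
      hamiltonian (fermionRectTorusGraph a b) t U *ᵥ ψ =
        ((groundEnergyAt (fermionRectTorusGraph a b) t U (a * b) : ℝ) : ℂ) • ψ ∧
      spinSq *ᵥ ψ = 0 ∧
      ∀ φ : Fock (Orb (Fin a ×ₗ Fin b)), IsNParticle (a * b) φ →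
        hamiltonian (fermionRectTorusGraph a b) t U *ᵥ φ =
          ((groundEnergyAt (fermionRectTorusGraph a b) t U (a * b) : ℝ) : ℂ) • φ →
          φ = (star ψ ⬝ᵥ φ) • ψ := by
  obtain ⟨hfin, hspin⟩ := hubbardRectTorus_finrank_groundSector_eq_one (a := a) (b := b) ha hb ht hU
  set H := hamiltonian (fermionRectTorusGraph a b) t U with hH
  set K : Submodule ℂ (Fock (Orb (Fin a ×ₗ Fin b))) :=
    nParticleSubmodule (ι := Orb (Fin a ×ₗ Fin b)) (a * b) with hK
  set V := H.sectorGroundSpace K with hV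
  have hHerm : H.IsHermitian := LiebThm1.hamiltonian_isHermitian (fermionRectTorusGraph a b) t U
  have hVne : V ≠ ⊥ := by
    intro h
    rw [h, finrank_bot] at hfin
    exact zero_ne_one hfin
  have hKne : K ≠ ⊥ := by
    intro h
    apply hVne
    rw [eq_bot_iff]
    intro v hv
    rw [← h]
    exact ((Matrix.mem_sectorGroundSpace_iff _ _ _).1 hv).1
  obtain ⟨ψ, hψK, hψ1, hHψ⟩ := exists_unit_eigen_minEnergyOn hHerm K
    (fun v hv => hamiltonian_mulVec_mem_nParticleSubmodule (fermionRectTorusGraph a b) t U hv) hKne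
  have hE : groundEnergyAt (fermionRectTorusGraph a b) t U (a * b) = H.minEnergyOn K :=
    groundEnergy_eq_minEnergyOn H (a * b) K (fun _ => Iff.rfl)
  have hψV : ψ ∈ V := (Matrix.mem_sectorGroundSpace_iff _ _ _).2 ⟨hψK, hHψ⟩
  have hψ0 : ψ ≠ 0 := by
    rintro rfl
    rw [dotProduct_zero] at hψ1
    exact zero_ne_one hψ1
  have hne : (⟨ψ, hψV⟩ : V) ≠ 0 := fun h => hψ0 (by simpa using congrArg Subtype.val h)
  have huniq : ∀ φ ∈ K, H *ᵥ φ = ((H.minEnergyOn K : ℝ) : ℂ) • φ → φ = (star ψ ⬝ᵥ φ) • ψ := by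
    intro φ hφK hHφ
    have hφV : φ ∈ V := (Matrix.mem_sectorGroundSpace_iff _ _ _).2 ⟨hφK, hHφ⟩
    obtain ⟨c, hc⟩ := (finrank_eq_one_iff_of_nonzero' _ hne).1 hfin ⟨φ, hφV⟩
    have hφeq : φ = c • ψ := by simpa using (congrArg Subtype.val hc).symm
    rw [hφeq, dotProduct_smul, hψ1, smul_eq_mul, mul_one]
  refine ⟨ψ, hubbardRectTorus_groundSector_le_szSector ha hb ht hU hψV, hψ1, ?_, hspin ψ hψV, ?_⟩
  · rw [hE]; exact hHψ
  · intro φ hφN hHφ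
    rw [hE] at hHφ
    exact huniq φ hφN hHφ

/-- **Half-filled ground states of the even rectangular torus are unique up to phase and singlets**:
an `ab`-particle `φ` with `H φ = E₀(ab) φ` spans the ground multiplet and has `S² φ = 0`.
[cite: LiebPRL1989, Theorem 2] -/
theorem hubbardRectTorus_spinSq_mulVec_eq_zero_of_eigen (ha : Even a) (hb : Even b) {t U : ℝ}
    (ht : t ≠ 0) (hU : 0 < U) {φ : Fock (Orb (Fin a ×ₗ Fin b))} (hN : IsNParticle (a * b) φ)
    (hHφ : hamiltonian (fermionRectTorusGraph a b) t U *ᵥ φ =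
      ((groundEnergyAt (fermionRectTorusGraph a b) t U (a * b) : ℝ) : ℂ) • φ) :
    spinSq *ᵥ φ = 0 := by
  obtain ⟨-, hspin⟩ := hubbardRectTorus_finrank_groundSector_eq_one (a := a) (b := b) ha hb ht hU
  refine hspin φ ((Matrix.mem_sectorGroundSpace_iff _ _ _).2 ⟨hN, ?_⟩)
  rw [← groundEnergy_eq_minEnergyOn (hamiltonian (fermionRectTorusGraph a b) t U) (a * b)
    (nParticleSubmodule (ι := Orb (Fin a ×ₗ Fin b)) (a * b)) (fun _ => Iff.rfl)]
  exact hHφ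

end RectLattice

end LiebHalfFilled

/-! ### The Gram blocks of THE half-filled ground state on even rectangular tori -/

section RectTorus

open LiebTwo

variable {a b : ℕ}

variable (a b) in
/-- The sublattice sign `ε_{(x,y)} = (-1)^{x+y}` of the rectangular torus as a complex number —
the `ε` of the Shiba words in the `liebgram` block. [cite: LiebPRL1989, Theorem 2] -/
def rectSign (p : Fin a ×ₗ Fin b) : ℂ := ((rectStagger a b p : ℤ) : ℂ)

/-- `ε_p ε_q = memSign A p · memSign A q` for the sublattice `A = {ε = +1}` (`ε = -memSign A`).
[folklore] -/
private theorem rectSign_mul_rectSign (p q : Fin a ×ₗ Fin b) :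
    rectSign a b p * rectSign a b q =
      memSign (univ.filter fun z : Fin a ×ₗ Fin b => rectStagger a b z = 1) p *
        memSign (univ.filter fun z : Fin a ×ₗ Fin b => rectStagger a b z = 1) q := by
  have h : ∀ z : Fin a ×ₗ Fin b, rectSign a b z =
      -memSign (univ.filter fun z : Fin a ×ₗ Fin b => rectStagger a b z = 1) z := by
    intro z
    simp only [rectSign, memSign, Finset.mem_filter, Finset.mem_univ, true_and]
    rcases Int.units_eq_one_or (rectStagger a b z) with hz | hz
    · rw [if_pos hz, hz, neg_neg]; simp
    · rw [if_neg (by rw [hz]; decide), hz]; simp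
  rw [h, h, neg_mul_neg]

variable [NeZero a] [NeZero b]

/-- **Lieb's Gram block on the even rectangular torus** (block kind `liebgram`): for every
half-filled ground state `ψ` of `hamiltonian (fermionRectTorusGraph a b) t U` (`a, b` even, `t ≠ 0`,
`U > 0`) and every finite family of words, `[⟨ψ, u(w i) d̃(w j) ψ⟩]_{ij} ⪰ 0` with `d̃` the Shiba
words of the sublattice sign `rectSign`. [cite: LiebPRL1989, proof of Theorem 2] -/
theorem hubbardRectTorus_liebGram_posSemidef (ha : Even a) (hb : Even b) {t U : ℝ} (ht : t ≠ 0)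
    (hU : 0 < U) {ψ : Fock (Orb (Fin a ×ₗ Fin b))} (hN : IsNParticle (a * b) ψ)
    (hHψ : hamiltonian (fermionRectTorusGraph a b) t U *ᵥ ψ =
      ((groundEnergyAt (fermionRectTorusGraph a b) t U (a * b) : ℝ) : ℂ) • ψ)
    {κ : Type*} [Fintype κ] (w : κ → List ((Fin a ×ₗ Fin b) × (Fin a ×ₗ Fin b))) :
    (Matrix.of fun i j : κ =>
      star ψ ⬝ᵥ ((upWord (w i) * shibaDownWord (rectSign a b) (w j)) *ᵥ ψ)).PosSemidef := by
  obtain ⟨hG, hA, h2⟩ := LiebHalfFilled.hubbardRectTorus_lieb_hypotheses (a := a) (b := b) ha hb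
  have hcard := LiebHalfFilled.compl_card_eq_card_of_two_mul h2
  rw [← card_rectSites] at hN hHψ
  exact liebGram_posSemidef hG _ hA hcard ht hU rectSign_mul_rectSign hN hHψ w

/-- **The flipped Gram block on the even rectangular torus** (block kind `liebgram_flip`):
`[⟨ψ, d(w i) ũ(w j) ψ⟩]_{ij} ⪰ 0`. [cite: LiebPRL1989, proof of Theorem 2] -/
theorem hubbardRectTorus_liebGram_posSemidef_flip (ha : Even a) (hb : Even b) {t U : ℝ}
    (ht : t ≠ 0) (hU : 0 < U) {ψ : Fock (Orb (Fin a ×ₗ Fin b))} (hN : IsNParticle (a * b) ψ)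
    (hHψ : hamiltonian (fermionRectTorusGraph a b) t U *ᵥ ψ =
      ((groundEnergyAt (fermionRectTorusGraph a b) t U (a * b) : ℝ) : ℂ) • ψ)
    {κ : Type*} [Fintype κ] (w : κ → List ((Fin a ×ₗ Fin b) × (Fin a ×ₗ Fin b))) :
    (Matrix.of fun i j : κ =>
      star ψ ⬝ᵥ ((downWord (w i) * shibaUpWord (rectSign a b) (w j)) *ᵥ ψ)).PosSemidef := by
  obtain ⟨hG, hA, h2⟩ := LiebHalfFilled.hubbardRectTorus_lieb_hypotheses (a := a) (b := b) ha hb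
  have hcard := LiebHalfFilled.compl_card_eq_card_of_two_mul h2
  rw [← card_rectSites] at hN hHψ
  exact liebGram_posSemidef_flip hG _ hA hcard ht hU rectSign_mul_rectSign hN hHψ w

/-- The Lieb form paired with `G ⪰ 0` is nonnegative in every half-filled ground state of the even
rectangular torus. [cite: LiebPRL1989, proof of Theorem 2] [cite: KullEtAl2024, §5.3] -/
theorem hubbardRectTorus_liebForm_expect_nonneg (ha : Even a) (hb : Even b) {t U : ℝ}
    (ht : t ≠ 0) (hU : 0 < U) {ψ : Fock (Orb (Fin a ×ₗ Fin b))} (hN : IsNParticle (a * b) ψ)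
    (hHψ : hamiltonian (fermionRectTorusGraph a b) t U *ᵥ ψ =
      ((groundEnergyAt (fermionRectTorusGraph a b) t U (a * b) : ℝ) : ℂ) • ψ)
    {κ : Type*} [Fintype κ] {Gm : Matrix κ κ ℂ} (hGm : Gm.PosSemidef)
    (w : κ → List ((Fin a ×ₗ Fin b) × (Fin a ×ₗ Fin b))) :
    0 ≤ star ψ ⬝ᵥ liebForm (rectSign a b) Gm w *ᵥ ψ := by
  obtain ⟨hG, hA, h2⟩ := LiebHalfFilled.hubbardRectTorus_lieb_hypotheses (a := a) (b := b) ha hb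
  have hcard := LiebHalfFilled.compl_card_eq_card_of_two_mul h2
  rw [← card_rectSites] at hN hHψ
  exact liebForm_expect_nonneg hG _ hA hcard ht hU rectSign_mul_rectSign hN hHψ hGm w

/-- The flipped Lieb form paired with `G ⪰ 0` is nonnegative in every half-filled ground state of
the even rectangular torus. [cite: LiebPRL1989, proof of Theorem 2] [cite: KullEtAl2024, §5.3] -/
theorem hubbardRectTorus_liebFormFlip_expect_nonneg (ha : Even a) (hb : Even b) {t U : ℝ}
    (ht : t ≠ 0) (hU : 0 < U) {ψ : Fock (Orb (Fin a ×ₗ Fin b))} (hN : IsNParticle (a * b) ψ)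
    (hHψ : hamiltonian (fermionRectTorusGraph a b) t U *ᵥ ψ =
      ((groundEnergyAt (fermionRectTorusGraph a b) t U (a * b) : ℝ) : ℂ) • ψ)
    {κ : Type*} [Fintype κ] {Gm : Matrix κ κ ℂ} (hGm : Gm.PosSemidef)
    (w : κ → List ((Fin a ×ₗ Fin b) × (Fin a ×ₗ Fin b))) :
    0 ≤ star ψ ⬝ᵥ liebFormFlip (rectSign a b) Gm w *ᵥ ψ := by
  obtain ⟨hG, hA, h2⟩ := LiebHalfFilled.hubbardRectTorus_lieb_hypotheses (a := a) (b := b) ha hb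
  have hcard := LiebHalfFilled.compl_card_eq_card_of_two_mul h2
  rw [← card_rectSites] at hN hHψ
  exact liebFormFlip_expect_nonneg hG _ hA hcard ht hU rectSign_mul_rectSign hN hHψ hGm w

end RectTorus

end Literature.MathematicalPhysics.QuantumLattice
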